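import Summits.BirchSwinnertonDyer.BirchSwinnertonDyer.Theorems.ClassRecordThreeHsiehDescentInertialItems
import HarnessLib

/-!
# Route `ClassRecordThree`, crux `HsiehDescentAtThree` (item stmt-BirchSwinnertonDyer-19108) — FINITE GALOIS ORBITS
# replace the Tate–Sen input: the twist exponent of a Hsieh witness dies on inertia as soon as SOME power of each
# inertial `τ` fixes the normalised series

Cell `bsd-stepL` (run/shared/lean/pub/bsd-stepL/), seat `bsd-stepL-desc3-p1` (prover g3), `--supports
stmt-BirchSwinnertonDyer-19108`. Helper file of `ClassRecordThreeHsiehDescentUnramifiedPeriod` (the Tate–Sen-free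
descent at `3 ∥ N`). Generic in the prime `p` where the statement allows.

## What this file proves (theorems only; no definition, no named fact)

* `exists_pos_pow_apply_eq` — for `τ ∈ Gal(ℚ̄_p/ℚ_p)` and `z ∈ ℚ̄_p` some `τ^k`, `k ≥ 1`, fixes `z` (the `τ`-orbit of
  `z` lies in the finite root set of its minimal polynomial; pigeonhole).
* `inertial_pow` — powers of an inertial `τ` are inertial.
* `twistExponent_eq_zero_on_inertia_of_fixed_pow` — if `E ≠ 0` in `𝓞_{ℂ_p}⟦T⟧` carries twist relations
  `T_τ Ē = (1+T)^{a(τ)} Ē` for all INERTIAL `τ` and for every inertial `τ` SOME `T_{τ^{k+1}}` fixes `Ē`, then `a = 0`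
  on inertia: `a` is additive on inertia (`twist_mul`, `extension_mul`, `twist_unique`), so `a(τ^{k+1}) = (k+1)·a(τ)`,
  and `a(τ^{k+1}) = 0` by uniqueness of the twist relation; `ℤ_p` is torsion-free. This is the statement that
  REPLACES `twistExponent_eq_zero_on_inertia_of_tateSenInertia` (g2, which needs the printed Tate–Sen theorem).
* `map_restrict_eq_self_of_extension_apply_period_eq` — the FIXED-SERIES criterion for a Hsieh witness: if the
  continuous extension `τ̂` of an inertial `τ` fixes the period `θ = ι′⁻¹((p/16A²)(Ω/Ω_K)⁴)·Ω_p⁴` and exact value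
  reciprocity holds along the base family `(χ₀^j)` for `σ = ι′τι′⁻¹`, then `E^τ = E` for the normalised series
  `E = ι′⁻¹(C)⁻¹Q` (values of `E^τ` and `E` agree at the transported family points `τ(u)^j − 1`, `j ≥ 1`, by x11b3's
  `transported_family_of_family` with `c = d = 1`, `e = 0`; identity principle `R1.intSeries_eq_of_hasValueAt`).

HONEST FRAMING: pure lemmas about power series over `𝓞_{ℂ_p}` and Hsieh witnesses; every arithmetic input is an
explicit hypothesis; nothing of K5-B, Tate–Sen or BSD is asserted; item 19108 OPEN; no census word (T7).

References: [Hsieh2014] Thm. 1 (arXiv:1112.1580 pp. 3–4); [Washington1997] §5.1; tree `X11b/Three/HsiehDescentInertia.lean`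
(`twist_unique`, `twist_mul`), `X11b/Three/HsiehDescentFamilyTwist.lean` (`transported_family_of_family`),
`X11b/BDPFrameUniquenessInt.lean` (`R1.intSeries_eq_of_hasValueAt`), `X11b/Three/CompletedGaloisAction.lean`.
-/

noncomputable section

set_option linter.dupNamespace false

open scoped NumberField Topology
open Filter NumberField IsDedekindDomain Field PowerSeries WeierstrassCurve
open Literature.NumberTheory.GaloisRepresentations Literature.NumberTheory.EllipticCurves
open Literature.NumberTheory.EllipticCurves.ModularForms
open Summit.BirchSwinnertonDyer.Rank1Residual Summit.BirchSwinnertonDyer.Rank1Residual.X11b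
open Summit.BirchSwinnertonDyer.Rank1Residual.X11b.Three Summit.BirchSwinnertonDyer.Rank1Residual.X11b.LambdaSupply
open Summit.BirchSwinnertonDyer.Rank1Residual.X11b.Three.LambdaSupply
open Summit.BirchSwinnertonDyer.Rank1Residual.X11b.PadicComplexTransport (continuous_algEquiv)
open Summit.BirchSwinnertonDyer.Rank1Residual.X11b.Three.RangeTransport

namespace Summit.BirchSwinnertonDyer.BirchSwinnertonDyer.Theorems

/-! ### §1 Finite Galois orbits in `ℚ̄_p` -/

/-- **Finite orbits**: for `τ ∈ Gal(ℚ̄_p/ℚ_p)` and `z ∈ ℚ̄_p` some positive power of `τ` fixes `z` — the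
`τ`-orbit of `z` lies in the finite root set of the minimal polynomial of `z` over `ℚ_p` (`ℚ̄_p/ℚ_p` is algebraic),
so `τ^i z = τ^j z` for some `i ≠ j`, whence `τ^{|j−i|} z = z`. [folklore] -/
theorem exists_pos_pow_apply_eq {p : ℕ} [Fact p.Prime] (τ : PadicAlgCl p ≃ₐ[ℚ_[p]] PadicAlgCl p)
    (z : PadicAlgCl p) : ∃ k : ℕ, 0 < k ∧ (τ ^ k) z = z := by
  classical
  have hz : IsIntegral ℚ_[p] z := Algebra.IsIntegral.isIntegral z
  have hP0 : minpoly ℚ_[p] z ≠ 0 := minpoly.ne_zero hz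
  have hmem : ∀ i : ℕ, (τ ^ i) z ∈ (minpoly ℚ_[p] z).rootSet (PadicAlgCl p) := fun i ↦ by
    rw [Polynomial.mem_rootSet]
    exact ⟨hP0, by rw [Polynomial.aeval_algHom_apply (τ ^ i) z, minpoly.aeval, map_zero]⟩
  haveI : Finite ((minpoly ℚ_[p] z).rootSet (PadicAlgCl p)) :=
    (Polynomial.rootSet_finite (minpoly ℚ_[p] z) (PadicAlgCl p)).to_subtype
  obtain ⟨i, j, hij, hfij⟩ := Finite.exists_ne_map_eq_of_infinite
    (fun i : ℕ ↦ (⟨(τ ^ i) z, hmem i⟩ : (minpoly ℚ_[p] z).rootSet (PadicAlgCl p)))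
  have hval : (τ ^ i) z = (τ ^ j) z := congrArg Subtype.val hfij
  have key : ∀ i j : ℕ, i < j → (τ ^ i) z = (τ ^ j) z → ∃ k : ℕ, 0 < k ∧ (τ ^ k) z = z := by
    intro i j hlt h
    refine ⟨j - i, Nat.sub_pos_of_lt hlt, ?_⟩
    have hj : τ ^ j = τ ^ i * τ ^ (j - i) := by rw [← pow_add, Nat.add_sub_cancel' hlt.le]
    rw [hj, AlgEquiv.mul_apply] at h
    exact ((τ ^ i).injective h).symm
  rcases lt_or_gt_of_ne hij with hlt | hgt
  · exact key i j hlt hval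
  · exact key j i hgt hval.symm

/-- Powers of an inertial `τ` (one fixing every root of unity of order prime to `p`) are inertial. [folklore] -/
theorem inertial_pow {p : ℕ} [Fact p.Prime] {τ : PadicAlgCl p ≃ₐ[ℚ_[p]] PadicAlgCl p}
    (hτ : ∀ ζ : PadicAlgCl p, (∃ m : ℕ, 0 < m ∧ ¬ p ∣ m ∧ ζ ^ m = 1) → τ ζ = ζ) (k : ℕ) :
    ∀ ζ : PadicAlgCl p, (∃ m : ℕ, 0 < m ∧ ¬ p ∣ m ∧ ζ ^ m = 1) → (τ ^ k) ζ = ζ := by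
  induction k with
  | zero => intro ζ _; rfl
  | succ k ih => intro ζ hζ; rw [pow_succ, AlgEquiv.mul_apply, hτ ζ hζ, ih ζ hζ]

/-! ### §2 The twist exponent dies on inertia when some power of each inertial `τ` fixes the series -/

variable {p : ℕ} [Fact p.Prime]

/-- **The twist exponent vanishes on inertia — FINITE-ORDER version (no Tate–Sen).** Let `E ≠ 0` in `𝓞_{ℂ_p}⟦T⟧`
carry, for every INERTIAL `τ` (continuous extensions `T_τ`), a twist relation `T_τ Ē = 1·(1+T)^{a(τ)}·Ē`, and suppose
that for every inertial `τ` some `T_{τ^{k+1}}` FIXES `Ē`. Then `a(τ) = 0` for every inertial `τ`: the exponent is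
additive on the inertia monoid (`twist_mul`, `extension_mul`, `twist_unique`), so `a(τ^{k+1}) = (k+1) • a(τ)`, while
`a(τ^{k+1}) = 0` by uniqueness of the twist relation of the fixed series; `ℤ_p` has characteristic zero.
[cite: Washington1997, §5.1] -/
theorem twistExponent_eq_zero_on_inertia_of_fixed_pow
    (T : (PadicAlgCl p ≃ₐ[ℚ_[p]] PadicAlgCl p) → ℂ_[p] →+* ℂ_[p])
    (hT : ∀ τ, Continuous (T τ)) (hTτ : ∀ τ (x : PadicAlgCl p), T τ x = τ x)
    {E : PowerSeries 𝓞_ℂ_[p]} (hE : E ≠ 0) {a : (PadicAlgCl p ≃ₐ[ℚ_[p]] PadicAlgCl p) → ℤ_[p]}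
    (h : ∀ τ, (∀ ζ : PadicAlgCl p, (∃ k : ℕ, 0 < k ∧ ¬ p ∣ k ∧ ζ ^ k = 1) → τ ζ = ζ) →
      (E.map (PadicComplexInt p).subtype).map (T τ) =
        C (1 : ℂ_[p]) * ((((binomialSeries ℤ_[p] (a τ)).map (R1.toCpInt p)) * E).map
          (PadicComplexInt p).subtype))
    (hfix : ∀ τ, (∀ ζ : PadicAlgCl p, (∃ k : ℕ, 0 < k ∧ ¬ p ∣ k ∧ ζ ^ k = 1) → τ ζ = ζ) →
      ∃ k : ℕ, (E.map (PadicComplexInt p).subtype).map (T (τ ^ (k + 1))) =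
        E.map (PadicComplexInt p).subtype) :
    ∀ τ, (∀ ζ : PadicAlgCl p, (∃ k : ℕ, 0 < k ∧ ¬ p ∣ k ∧ ζ ^ k = 1) → τ ζ = ζ) → a τ = 0 := by
  -- (a) the exponent is additive on inertia
  have hmul : ∀ τ₁ τ₂, (∀ ζ : PadicAlgCl p, (∃ m : ℕ, 0 < m ∧ ¬ p ∣ m ∧ ζ ^ m = 1) → τ₁ ζ = ζ) →
      (∀ ζ : PadicAlgCl p, (∃ m : ℕ, 0 < m ∧ ¬ p ∣ m ∧ ζ ^ m = 1) → τ₂ ζ = ζ) →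
      a (τ₁ * τ₂) = a τ₁ + a τ₂ := by
    intro τ₁ τ₂ h₁ h₂
    have h₁₂ : ∀ ζ : PadicAlgCl p, (∃ m : ℕ, 0 < m ∧ ¬ p ∣ m ∧ ζ ^ m = 1) → (τ₁ * τ₂) ζ = ζ :=
      fun ζ hζ ↦ by rw [AlgEquiv.mul_apply, h₂ ζ hζ, h₁ ζ hζ]
    have h12 := twist_mul (hTτ τ₁) (h τ₁ h₁) (h τ₂ h₂)
    have hT12 : T (τ₁ * τ₂) = (T τ₁).comp (T τ₂) :=
      extension_mul (hT τ₁) (hTτ τ₁) (hT τ₂) (hTτ τ₂) (hT _) (hTτ _)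
    have h' : (E.map (PadicComplexInt p).subtype).map (T (τ₁ * τ₂)) =
        ((E.map (PadicComplexInt p).subtype).map (T τ₂)).map (T τ₁) := by
      rw [hT12, map_comp, RingHom.comp_apply]
    rw [h (τ₁ * τ₂) h₁₂, h12] at h'
    exact (twist_unique hE one_ne_zero (h'.trans (by rw [map_one, mul_one]))).2
  -- (b) hence `a (τ^(j+1)) = (j+1) • a τ` for inertial `τ`
  have hpow : ∀ τ, (∀ ζ : PadicAlgCl p, (∃ m : ℕ, 0 < m ∧ ¬ p ∣ m ∧ ζ ^ m = 1) → τ ζ = ζ) →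
      ∀ j : ℕ, a (τ ^ (j + 1)) = (j + 1) • a τ := by
    intro τ hτ j
    induction j with
    | zero => rw [zero_add, pow_one, one_smul]
    | succ j ih =>
      rw [pow_succ, hmul _ _ (inertial_pow hτ (j + 1)) hτ, ih]
      exact (succ_nsmul (a τ) (j + 1)).symm
  -- (c) a fixed power has exponent zero; divide by `k + 1`
  intro τ hτ
  obtain ⟨k, hk⟩ := hfix τ hτ
  have hτk := inertial_pow hτ (k + 1)
  have h' : (E.map (PadicComplexInt p).subtype).map (T (τ ^ (k + 1))) =
      PowerSeries.C (1 : ℂ_[p]) *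
        ((((PowerSeries.binomialSeries ℤ_[p] (0 : ℤ_[p])).map (R1.toCpInt p)) * E).map
          (PadicComplexInt p).subtype) := by
    rw [hk, binomialSeries_zero, map_one, one_mul, map_one, one_mul]
  have hak : a (τ ^ (k + 1)) = 0 := (twist_unique hE one_ne_zero ((h (τ ^ (k + 1)) hτk).symm.trans h')).2
  rw [hpow τ hτ k, nsmul_eq_mul] at hak
  have hk0 : ((k + 1 : ℕ) : ℤ_[p]) ≠ 0 := by exact_mod_cast Nat.succ_ne_zero k
  exact (mul_eq_zero.1 hak).resolve_left hk0

/-! ### §3 The fixed-series criterion for a Hsieh witness with an `τ̂`-fixed period -/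

variable {K : Type} [Field K] [NumberField K] {N : ℕ}

/-- **`E^τ = E` when `τ̂` fixes the period and value reciprocity is exact along the base family.** Data as in x11b3's
`exists_twist_of_family` with `c = d = 1`, `e = 0`: a Hsieh witness `Q` (`p ∣ N`), a period `Ω ≠ 0`, `θ =
ι⁻¹((p/16A²)(Ω/Ω_K)⁴)·Ω_p⁴ ≠ 0`, `τ` with continuous extension `T` and coefficient map `φ`, `σ` over `τ` fixing the
embeddings of `K`, a base range point `(χ₀, n₀, ψ₀)` with `u = ψ₀(γ)`, `‖u − 1‖ < p⁻¹`, `u ≠ 1`, EXACT reciprocity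
`σ(V(χ₀^j)) = V(^σ(χ₀^j))` for `j ≥ 1` in the (VR-A) format with `c = d = 1`, `e = 0` (hypothesis `hVRA`), and the normalised series `E` (`[T^k]E = ι⁻¹(C)⁻¹[T^k]Q`).
IF `T θ = θ`, then `E.map φ = E`: by `transported_family_of_family` the values of `E` and of `E^τ` at the transported
points `τ(u)^j − 1`, `j ≥ 1`, are both `θ^{j n₀}·ι⁻¹V(^σ(χ₀^j))` (the cocycle factor `(Tθ/θ)^{n₀}` is `1`), and two
integral series agreeing along `τ(u)^{p^i} − 1 → 0` are equal (`R1.intSeries_eq_of_hasValueAt`).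
[cite: Hsieh2014, Thm. 1 (arXiv:1112.1580 pp. 3–4)] [cite: Washington1997, §5.1] -/
theorem map_restrict_eq_self_of_extension_apply_period_eq (ι : PadicAlgCl p ≃+* ℂ)
    {𝔭 : HeightOneSpectrum (𝓞 K)} {κ : ZpExtension K p} {γ : absoluteGaloisGroup K}
    {f : CuspForm (CongruenceSubgroup.Gamma0 N) 2} {A : ℝ} {ΩK C : ℂ} {Ωp : ℂ_[p]}
    {Q : PowerSeries 𝓞_ℂ_[p]} (hQ : IsHsiehLFunction ι 𝔭 κ γ f A ΩK C Ωp Q) (hpN : p ∣ N) {Ω : ℂ}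
    (hΩ : Ω ≠ 0)
    (hθ : (((ι.symm (((p : ℂ) / (16 * (A : ℂ) ^ 2)) * (Ω / ΩK) ^ 4) : PadicAlgCl p) : ℂ_[p]) * Ωp ^ 4) ≠ 0)
    (hC : ((ι.symm C : PadicAlgCl p) : ℂ_[p]) ≠ 0) (hK : ∀ w : InfinitePlace K, ¬ w.IsReal)
    {τ : PadicAlgCl p ≃ₐ[ℚ_[p]] PadicAlgCl p} {T : ℂ_[p] →+* ℂ_[p]} (hT : Continuous T)
    (hTτ : ∀ x : PadicAlgCl p, T x = τ x)
    {φ : PadicComplexInt p →+* PadicComplexInt p} (hφ : ∀ y : PadicComplexInt p, (φ y : ℂ_[p]) = T y)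
    {σ : ℂ ≃ₐ[ℚ] ℂ} (hστ : ∀ z : PadicAlgCl p, σ (ι z) = ι (τ z))
    (hσK : ∀ (φ' : K →+* ℂ) (k : K), σ (φ' k) = φ' k)
    {χ₀ : HeckeCharacter K} {n₀ : ℕ} (hn₀ : 0 < n₀)
    (hunr₀ : ∀ v : HeightOneSpectrum (𝓞 K), χ₀.IsUnramifiedAt v)
    (hχ₀ : χ₀.HasInfinityType (fun _ ↦ (n₀ : ℤ)) (fun _ ↦ -(n₀ : ℤ)))
    (hVRA : ∀ j : ℕ, 0 < j →
      σ (bdpInterpolationValue p f 𝔭 (χ₀ ^ j) (j * n₀) Ω) =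
        1 * 1 ^ (j * n₀) * ((0 : HeightOneSpectrum (𝓞 K) →₀ ℤ).prod
          fun v k' ↦ ((hasInfinityType_pow_range hχ₀ j).autConj σ).valueAtUniformizer v ^ k') *
          bdpInterpolationValue p f 𝔭 ((hasInfinityType_pow_range hχ₀ j).autConj σ) (j * n₀) Ω)
    {ψ₀ : absoluteGaloisGroup K →ₜ* (PadicAlgCl p)ˣ}
    (hav₀ : IsPAdicAvatarOf ι χ₀ ((FramedRep.unitsContinuousMulEquivOfUnique (Fin 1) (PadicAlgCl p) :
      (PadicAlgCl p)ˣ →ₜ* GL (Fin 1) (PadicAlgCl p)).comp ψ₀))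
    (hfac₀ : FactorsThroughZp κ ((FramedRep.unitsContinuousMulEquivOfUnique (Fin 1) (PadicAlgCl p) :
      (PadicAlgCl p)ˣ →ₜ* GL (Fin 1) (PadicAlgCl p)).comp ψ₀))
    (hu : ‖(((ψ₀ γ : (PadicAlgCl p)ˣ) : PadicAlgCl p) : ℂ_[p]) - 1‖ < (p : ℝ)⁻¹)
    (hu1 : ((ψ₀ γ : (PadicAlgCl p)ˣ) : PadicAlgCl p) ≠ 1)
    {E : PowerSeries 𝓞_ℂ_[p]}
    (hE : ∀ k, ((coeff k E : 𝓞_ℂ_[p]) : ℂ_[p]) =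
      (((ι.symm C : PadicAlgCl p) : ℂ_[p]))⁻¹ * ((coeff k Q : 𝓞_ℂ_[p]) : ℂ_[p]))
    (hTθ : T ((((ι.symm (((p : ℂ) / (16 * (A : ℂ) ^ 2)) * (Ω / ΩK) ^ 4) : PadicAlgCl p) : ℂ_[p]) * Ωp ^ 4)) =
      (((ι.symm (((p : ℂ) / (16 * (A : ℂ) ^ 2)) * (Ω / ΩK) ^ 4) : PadicAlgCl p) : ℂ_[p]) * Ωp ^ 4)) :
    E.map φ = E := by
  have hp : p.Prime := Fact.out
  set CC : ℂ_[p] := ((ι.symm C : PadicAlgCl p) : ℂ_[p]) with hCC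
  set θ : ℂ_[p] := (((ι.symm (((p : ℂ) / (16 * (A : ℂ) ^ 2)) * (Ω / ΩK) ^ 4) : PadicAlgCl p) :
    ℂ_[p]) * Ωp ^ 4) with hθdef
  -- the transported base point `x = τ(u)`
  set u : ℂ_[p] := (((ψ₀ γ : (PadicAlgCl p)ˣ) : PadicAlgCl p) : ℂ_[p]) with hudef
  set x : ℂ_[p] := ((τ ((ψ₀ γ : (PadicAlgCl p)ˣ) : PadicAlgCl p) : PadicAlgCl p) : ℂ_[p]) with hxdef
  have hTinj : Function.Injective T := (extension_bijective hT hTτ).1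
  have hxu : x = T u := by rw [hxdef, hudef, hTτ]
  have hx : ‖x - 1‖ < (p : ℝ)⁻¹ := by
    rw [hxu, ← map_one T, ← map_sub, norm_extension hT hTτ]; exact hu
  have hx1 : x ≠ 1 := by
    intro h1
    rw [hxu, ← map_one T] at h1
    have h2 : u = 1 := hTinj h1
    exact hu1 ((algebraMap (PadicAlgCl p) ℂ_[p]).injective (h2.trans (map_one _).symm))
  have hp1 : (p : ℝ)⁻¹ < 1 := inv_lt_one_of_one_lt₀ (by exact_mod_cast hp.one_lt)
  have hxlt : ‖x - 1‖ < 1 := hx.trans hp1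
  have h1 : ((ι.symm (1 : ℂ) : PadicAlgCl p) : ℂ_[p]) = 1 := by rw [map_one]; rfl
  have h1' : ((1 : PadicAlgCl p) : ℂ_[p]) = 1 := by rw [PadicComplex.coe_eq, map_one]
  -- values of `E` and of `E^τ` at `x^j − 1`, `j ≥ 1`, AGREE
  have hagree : ∀ j : ℕ, 0 < j → ∃ V : ℂ_[p], IntSeries.HasValueAt E (x ^ j - 1) V ∧
      IntSeries.HasValueAt (E.map φ) (x ^ j - 1) V := by
    intro j hj
    obtain ⟨hi, hii, hiii⟩ := transported_family_of_family ι hQ hpN hΩ hθ hK hTτ hστ hσK (c := 1) (d := 1)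
      (e := 0) hn₀ hunr₀ hχ₀ hVRA hav₀ hfac₀ hj
    simp only [← hCC, ← hθdef] at hi hii
    -- with `c = d = 1`, `e = 0` and `τ̂θ = θ` the cocycle factor is `1`
    simp only [Finsupp.prod_zero_index, map_one, h1', hTθ, one_mul, mul_one, mul_inv_cancel₀ hθ,
      one_pow] at hii
    have hTC : T CC ≠ 0 := (map_ne_zero_iff T hTinj).2 hC
    refine ⟨θ ^ (j * n₀) * ((ι.symm (bdpInterpolationValue p f 𝔭
      ((hasInfinityType_pow_range hχ₀ j).autConj σ) (j * n₀) Ω) : PadicAlgCl p) : ℂ_[p]), ?_, ?_⟩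
    · have h := hasValueAt_of_coeff_eq_mul hE hi
      rwa [mul_assoc CC, inv_mul_cancel_left₀ hC] at h
    · -- the untransported `j`-th point and its value, moved by `τ̂`
      have hjn : 0 < j * n₀ := Nat.mul_pos hj hn₀
      have hQj : IntSeries.HasValueAt Q (u ^ j - 1) (CC * θ ^ (j * n₀) *
          ((ι.symm (bdpInterpolationValue p f 𝔭 (χ₀ ^ j) (j * n₀) Ω) : PadicAlgCl p) : ℂ_[p])) := by
        have h := hasValueAt_normalForm ι hQ hpN hΩ hjn (fun v ↦ isUnramifiedAt_pow' (hunr₀ v) j)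
          (hasInfinityType_pow_range hχ₀ j) (isPAdicAvatarOf_pow ι hav₀ (fun v _ ↦ hunr₀ v) j)
          (factorsThroughZp_unitsChar_pow κ hfac₀ j)
        rwa [avatarValueAt_unitsChar_pow, avatarValueAt_unitsChar] at h
      have h2 := hasValueAt_map_extension hT hφ (hasValueAt_of_coeff_eq_mul hE hQj)
      rw [hiii, map_mul T, map_inv₀, hii, inv_mul_cancel_left₀ hTC] at h2
      exact h2
  -- identity principle along `x^{p^i} − 1 → 0`
  choose V hV hV' using fun i : ℕ ↦
    (show ∃ V : ℂ_[p], IntSeries.HasValueAt E (x ^ p ^ i - 1) V ∧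
        IntSeries.HasValueAt (E.map φ) (x ^ p ^ i - 1) V from hagree (p ^ i) (pow_pos hp.pos i))
  have hlim : Tendsto (fun i : ℕ ↦ x ^ p ^ i - 1) atTop (𝓝 0) := by
    have h := (tendsto_pow_prime_pow_padicComplex (p := p) hxlt).sub_const 1
    rwa [sub_self] at h
  have hne : ∃ᶠ i in atTop, x ^ p ^ i - 1 ≠ 0 := by
    refine Frequently.of_forall fun i h => hx1 ?_
    have hk' : ‖x ^ p ^ i - 1‖ = ((p : ℝ)⁻¹) ^ i * ‖x - 1‖ := R1.norm_pow_prime_pow_sub_one hx i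
    rw [h, norm_zero] at hk'
    have hpk : 0 < ((p : ℝ)⁻¹) ^ i := pow_pos (inv_pos.mpr (by exact_mod_cast hp.pos)) i
    have : ‖x - 1‖ = 0 := by nlinarith [norm_nonneg (x - 1)]
    exact sub_eq_zero.mp (norm_eq_zero.mp this)
  exact (R1.intSeries_eq_of_hasValueAt hlim hne hV hV').symm

end Summit.BirchSwinnertonDyer.BirchSwinnertonDyer.Theorems

end
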